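import Literature.Analysis.SpecialFunctions.SemigroupPosDefSmooth
import Literature.Analysis.Complex.LittleBernsteinHalfPlane
import Literature.Analysis.Complex.VitaliConvergence
import Mathlib.Analysis.Complex.Convex
import HarnessLib

/-!
# Bernstein–Widder continuation: positive definite functions on `(0,∞)` are holomorphic in the
# right half-plane

**Theorem** (`exists_differentiableOn_halfPlane_of_isSemigroupPosDef`).  Let `f : ℝ → ℝ` be
continuous on `(0,∞)`, positive definite on the additive semigroup `((0,∞),+)`
(`∑ cᵢcⱼ f(sᵢ+sⱼ) ≥ 0`, written out as the hypothesis) and bounded above on every `[t₀,∞)`.  Then there is a function `F`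
holomorphic on the open right half-plane with `F t = f t` for `t > 0` and `‖F z‖ ≤ f (Re z)`.

Classically this is read off the Bernstein–Widder representation `f(t) = ∫ e^{-λt} dμ(λ)`,
`μ ≥ 0` [cite: Widder1941, Ch. VI Thm. 21 and Ch. IV Thm. 12a], [cite: BergChristensenRessel1984,
Ch. 4 §4 and Thm. 6.13 (bounded / exponentially bounded positive definite functions on abelian
semigroups)]: `F(z) = ∫ e^{-λz} dμ(λ)`.  The proof here is measure-free:

1. positive definite + bounded ⇒ all iterated differences alternate
   (`Literature/Analysis/SpecialFunctions/SemigroupPosDef.lean`);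
2. smoothing by a one-sided bump inside the class, derivatives stay in the class ⇒ smooth
   completely monotone approximants `f(t + 2/n) ≤ hₙ(t) ≤ f(t + 1/n)`
   (`…/SemigroupPosDefSmooth.lean`);
3. little Bernstein theorem: each `hₙ` extends holomorphically to `{Re z > 0}` with
   `‖Hₙ z‖ ≤ hₙ(Re z)` (`Literature/Analysis/Complex/LittleBernstein*.lean`);
4. Vitali's convergence theorem (`Literature/Analysis/Complex/VitaliConvergence.lean`): the `Hₙ`
   are locally bounded and converge at the real points, hence locally uniformly to the desired `F`.

This is the one-mirror analytic input of reflection positivity (Osterwalder–Schrader / Widder):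
see `Summits/CriticalPhenomena/…/Theorems/PrecisionLaplacianStableConeRPRigidityHalfPlaneContinuation.lean`.
-/

noncomputable section

open Set Filter Metric MeasureTheory
open scoped Topology ContDiff

namespace Literature.Analysis.Complex

open Literature.Analysis.SpecialFunctions

/-- The shifted and flattened function `t ↦ f (a + max t 0)`: continuous on `ℝ` when `f` is
continuous on `(0,∞)` and `a > 0`, and agreeing with the translate `f (· + a)` on `[0, ∞)`.
[folklore] -/
theorem continuous_shiftFlat {f : ℝ → ℝ} (hc : ContinuousOn f (Ioi 0)) {a : ℝ} (ha : 0 < a) :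
    Continuous (fun t => f (a + max t 0)) := by
  have h1 : Continuous (fun t : ℝ => a + max t 0) := continuous_const.add (continuous_id.max continuous_const)
  refine hc.comp_continuous h1 fun t => ?_
  simp only [Set.mem_Ioi]
  have := le_max_right t 0
  linarith

/-- The shifted and flattened function is positive definite and bounded above on every `[t₀,∞)`
when `f` is. [folklore] -/
theorem shiftFlat_mem {f : ℝ → ℝ} (h : (∀ (m : ℕ) (s c : Fin m → ℝ), (∀ k₀, 0 < s k₀) → 0 ≤ ∑ i₁, ∑ i₂, c i₁ * c i₂ * (f (s i₁ + s i₂)))) (hb : (∀ t₀ : ℝ, 0 < t₀ → ∃ M : ℝ, ∀ τ : ℝ, t₀ ≤ τ → (f τ) ≤ M)) {a : ℝ} (ha : 0 < a) :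
    (∀ (m : ℕ) (s c : Fin m → ℝ), (∀ k₀, 0 < s k₀) → 0 ≤ ∑ i₁, ∑ i₂, c i₁ * c i₂ * (f (a + max (s i₁ + s i₂) 0))) ∧ (∀ t₀ : ℝ, 0 < t₀ → ∃ M : ℝ, ∀ τ : ℝ, t₀ ≤ τ → (f (a + max τ 0)) ≤ M) := by
  have heq : ∀ t, 0 < t → f (t + a) = f (a + max t 0) := fun t ht => by
    rw [max_eq_left ht.le, add_comm]
  refine ⟨SemigroupPosDef.congr (f := fun t => f (t + a)) (g := fun t => f (a + max t 0))
    (SemigroupPosDef.shift h ha.le) heq, ?_⟩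
  refine SemigroupPosDef.bdd_congr (f := fun t => f (t + a)) (g := fun t => f (a + max t 0)) ?_ heq
  intro t₀ ht₀
  obtain ⟨M, hM⟩ := hb t₀ ht₀
  exact ⟨M, fun t ht => hM _ (by linarith)⟩

/-- **Bernstein–Widder continuation to the right half-plane.**  A function `f : ℝ → ℝ` that is
continuous on `(0,∞)`, positive definite on the additive semigroup `((0,∞),+)` and bounded above
on every `[t₀,∞)` is the restriction of a function `F` holomorphic on `{Re z > 0}` with
`‖F z‖ ≤ f (Re z)`. [cite: Widder1941, Ch. VI Thm. 21; Ch. IV Thm. 12a] -/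
theorem exists_differentiableOn_halfPlane_of_isSemigroupPosDef {f : ℝ → ℝ}
    (hc : ContinuousOn f (Ioi 0)) (h : (∀ (m : ℕ) (s c : Fin m → ℝ), (∀ k₀, 0 < s k₀) → 0 ≤ ∑ i₁, ∑ i₂, c i₁ * c i₂ * (f (s i₁ + s i₂)))) (hb : (∀ t₀ : ℝ, 0 < t₀ → ∃ M : ℝ, ∀ τ : ℝ, t₀ ≤ τ → (f τ) ≤ M)) :
    ∃ F : ℂ → ℂ, DifferentiableOn ℂ F {z : ℂ | 0 < z.re} ∧ (∀ t : ℝ, 0 < t → F t = f t) ∧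
      ∀ z : ℂ, 0 < z.re → ‖F z‖ ≤ f z.re := by
  -- Step 1–2: smooth completely monotone approximants `hₙ`, `aₙ = 1/(n+1)`
  set a : ℕ → ℝ := fun n => 1 / ((n : ℝ) + 1) with ha
  have hapos : ∀ n, 0 < a n := fun n => by rw [ha]; positivity
  have hatend : Tendsto a atTop (𝓝 0) := tendsto_one_div_add_atTop_nhds_zero_nat
  have happrox : ∀ n : ℕ, ∃ hn : ℝ → ℝ, ContDiff ℝ ∞ hn ∧ (∀ (m : ℕ) (s c : Fin m → ℝ), (∀ k₀, 0 < s k₀) → 0 ≤ ∑ i₁, ∑ i₂, c i₁ * c i₂ * (hn (s i₁ + s i₂))) ∧ (∀ t₀ : ℝ, 0 < t₀ → ∃ M : ℝ, ∀ τ : ℝ, t₀ ≤ τ → (hn τ) ≤ M) ∧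
      ∀ t, 0 < t → f (a n + (t + a n)) ≤ hn t ∧ hn t ≤ f (a n + t) := by
    intro n
    obtain ⟨hPD, hBdd⟩ := shiftFlat_mem h hb (hapos n)
    obtain ⟨g, hg1, hg2, hg3, hg4⟩ :=
      SemigroupPosDef.exists_smooth_approx (g := fun t => f (a n + max t 0)) hPD hBdd
        (continuous_shiftFlat hc (hapos n)) (hapos n)
    refine ⟨g, hg1, hg2, hg3, fun t ht => ?_⟩
    have := hg4 t ht
    rwa [max_eq_left (by linarith [hapos n] : (0:ℝ) ≤ t + a n), max_eq_left ht.le] at this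
  choose hn hsmooth hPDn hBddn hsqueeze using happrox
  -- Step 3: holomorphic extensions `Hₙ` with `‖Hₙ z‖ ≤ hₙ (Re z)`
  have hext : ∀ n : ℕ, ∃ H : ℂ → ℂ, DifferentiableOn ℂ H {z : ℂ | 0 < z.re} ∧
      (∀ t : ℝ, 0 < t → H t = hn n t) ∧ ∀ z : ℂ, 0 < z.re → ‖H z‖ ≤ hn n z.re := fun n =>
    exists_differentiableOn_halfPlane_of_cm (hsmooth n)
      (fun k t ht => SemigroupPosDef.iteratedDeriv_alternating_nonneg (hPDn n) (hBddn n) (hsmooth n) k ht)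
  choose H hHd hHreal hHbound using hext
  -- Step 4: Vitali
  set U : Set ℂ := {z : ℂ | 0 < z.re} with hU
  have hUo : IsOpen U := isOpen_lt continuous_const Complex.continuous_re
  have hUc : IsPreconnected U := (convex_halfSpace_re_gt (0 : ℝ)).isPreconnected
  -- local boundedness
  have hbdd : ∀ w ∈ U, ∃ M : ℝ, ∃ r > 0, ∀ n, ∀ z ∈ ball w r ∩ U, ‖H n z‖ ≤ M := by
    intro w hw
    have hw' : 0 < w.re := hw
    obtain ⟨M, hM⟩ := hb (w.re / 2) (by linarith)
    refine ⟨M, w.re / 2, by linarith, fun n z hz => ?_⟩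
    have hzre : w.re / 2 < z.re := by
      have h1 : ‖z - w‖ < w.re / 2 := by simpa [dist_eq_norm] using hz.1
      have h2 : |(z - w).re| ≤ ‖z - w‖ := Complex.abs_re_le_norm _
      rw [Complex.sub_re] at h2
      linarith [(abs_lt.mp (h2.trans_lt h1)).1]
    have hzpos : 0 < z.re := by linarith
    calc ‖H n z‖ ≤ hn n z.re := hHbound n z hzpos
      _ ≤ f (a n + z.re) := (hsqueeze n z.re hzpos).2
      _ ≤ M := hM _ (by linarith [hapos n])
  -- pointwise convergence at the real points `t ∈ (1/2, 3/2)` (indeed at every `t > 0`)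
  have hptw : ∀ t : ℝ, 0 < t → Tendsto (fun n => H n t) atTop (𝓝 ((f t : ℝ) : ℂ)) := by
    intro t ht
    have hct : ContinuousAt f t := hc.continuousAt (Ioi_mem_nhds ht)
    -- both squeeze bounds tend to `f t`
    have hup : Tendsto (fun n => f (a n + t)) atTop (𝓝 (f t)) := by
      have : Tendsto (fun n => a n + t) atTop (𝓝 (0 + t)) := hatend.add tendsto_const_nhds
      rw [zero_add] at this
      exact hct.tendsto.comp this
    have hlow : Tendsto (fun n => f (a n + (t + a n))) atTop (𝓝 (f t)) := by
      have : Tendsto (fun n => a n + (t + a n)) atTop (𝓝 (0 + (t + 0))) :=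
        hatend.add (tendsto_const_nhds.add hatend)
      rw [zero_add, add_zero] at this
      exact hct.tendsto.comp this
    have hreal : Tendsto (fun n => hn n t) atTop (𝓝 (f t)) :=
      tendsto_of_tendsto_of_tendsto_of_le_of_le hlow hup (fun n => (hsqueeze n t ht).1)
        fun n => (hsqueeze n t ht).2
    have := (Complex.continuous_ofReal.tendsto _).comp hreal
    refine this.congr fun n => ?_
    simp only [Function.comp_apply, hHreal n t ht]
  have hfreq : ∃ᶠ z in 𝓝[≠] ((1 : ℝ) : ℂ), ∃ c : ℂ, Tendsto (fun n => H n z) atTop (𝓝 c) :=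
    frequently_of_forall_real (p := fun z => ∃ c : ℂ, Tendsto (fun n => H n z) atTop (𝓝 c))
      (a := 1 / 2) (b := 3 / 2) (by norm_num) fun t ht => ⟨_, hptw t (by linarith [ht.1])⟩
  have h1U : ((1 : ℝ) : ℂ) ∈ U := by simp [hU]
  obtain ⟨F, hFd, hFlim⟩ :=
    exists_tendstoLocallyUniformlyOn_of_frequently_tendsto hUo hUc hHd hbdd h1U hfreq
  refine ⟨F, hFd, fun t ht => ?_, fun z hz => ?_⟩
  · have h1 : Tendsto (fun n => H n t) atTop (𝓝 (F t)) := hFlim.tendsto_at (by simpa [hU] using ht)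
    exact tendsto_nhds_unique h1 (hptw t ht)
  · have h1 : Tendsto (fun n => ‖H n z‖) atTop (𝓝 ‖F z‖) := (hFlim.tendsto_at hz).norm
    have h2 : Tendsto (fun n => f (a n + z.re)) atTop (𝓝 (f z.re)) := by
      have hct : ContinuousAt f z.re := hc.continuousAt (Ioi_mem_nhds hz)
      have : Tendsto (fun n => a n + z.re) atTop (𝓝 (0 + z.re)) := hatend.add tendsto_const_nhds
      rw [zero_add] at this
      exact hct.tendsto.comp this
    exact le_of_tendsto_of_tendsto' h1 h2 fun n =>
      (hHbound n z hz).trans (hsqueeze n z.re hz).2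

end Literature.Analysis.Complex
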